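import Mathlib
import HarnessLib
import Literature.Analysis.FluidPDE.TypeIAncientMildClassical
import Literature.Analysis.FluidPDE.ClassicalLocalEnergyCutoff

/-!
# Route SymmetryModuliCount — crux `FarPastLedger`, line `uloc-gronwall-transplant`:
  tools for the linear flux ledger (stub LFL)

Theorems support file serving the crux item stmt-NavierStokesRegularity-14060
(`Summit.NavierStokesRegularity.NavierStokesRegularity.Theses.SymmetryModuliCount.FarPastLedger`),
line `uloc-gronwall-transplant`, registered stub `stub_fplLinearFluxLedger` (LFL), proved in the
companion file `SymmetryModuliCountFarPastLedgerLinearFluxLedger.lean`; registered tools sub-goal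
`fpl_LFL_fluxSliceBound`. Slice-wise (fixed time) estimates of the three flux terms of the local
energy identity of a classical Navier–Stokes pair against a time-independent cut-off `φ` adapted
to `B₁(x₀) ⊂ B₂(x₀)` (`IsClassicalNSSolutionOn.local_energy_identity_cutoff`):
`fpl_LFL_exists_cutoff` (the cut-off `φ₀(· − x₀)`, `φ₀` Mathlib's smooth bump, centre-independent
bounds `‖∇φ‖ ≤ c₁`, `|Δφ| ≤ c₂`); `fpl_LFL_laplacian_term_le` (`∫ Δφ |v|² ≤ c₂ ∫_{B₃}|v|²`);
`fpl_LFL_transport_term_le` (`∫ Dφ(v)|v|² ≤ c₁ M ∫_{B₂}|v|²`, `‖v‖ ≤ M`);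
`fpl_LFL_pressure_term_le` (for `q = c + p₁ + p₂` on `B₂(x₀)` and the mean-zero pairing density
`D = Dφ(v)` — `v` weakly divergence free — the constants drop out, `|∫ p₁ D| ≤ ‖p₁‖₂‖D‖₂` by
Hölder, `|p₂(z) − p₂(x₀)| ≤ 2 sup_{B₂}‖∇p₂‖` by the mean value inequality on the convex ball);
`fpl_LFL_flux_slice_le` (all three); `fpl_LFL_integral_inv_sqrt` (the crossing number
`∫_{s'}^{t'} (−τ)^{-1/2} dτ = 2(√(−s') − √(−t'))`).

References: L. Caffarelli, R. Kohn, L. Nirenberg, CPAM 35 (1982), §2 (local energy inequality,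
the flux terms); elementary otherwise (Hölder, mean value inequality, FTC).
-/

noncomputable section

open MeasureTheory Set Filter Metric Topology Function
open Literature.Analysis.FluidPDE
open scoped Laplacian RealInnerProductSpace ContDiff

set_option linter.dupNamespace false -- nested layout Summit.<S>.<Sub>, Sub = S (D-0017)

namespace Summit.NavierStokesRegularity.NavierStokesRegularity.Theorems

/-- A smooth cut-off adapted to `B₁(x₀) ⊂ B₂(x₀)` — the translate `φ₀(· − x₀)` of Mathlib's bump
`φ₀` at the origin (`= 1` on `B̄₁`, `supp = B₂`, `0 ≤ φ₀ ≤ 1`) — with centre-independent bounds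
`‖∇φ‖ ≤ c₁`, `|Δφ| ≤ c₂`. -/
theorem fpl_LFL_exists_cutoff :
    ∃ c₁ c₂ : ℝ, 0 ≤ c₁ ∧ 0 ≤ c₂ ∧ ∀ x₀ : EuclideanSpace ℝ (Fin 3),
      ∃ φ : EuclideanSpace ℝ (Fin 3) → ℝ,
      ContDiff ℝ ∞ φ ∧ HasCompactSupport φ ∧ (∀ z, 0 ≤ φ z) ∧ (∀ z, φ z ≤ 1) ∧
      (∀ z ∈ ball x₀ 1, φ z = 1) ∧ (∀ z, z ∉ ball x₀ 2 → φ z = 0) ∧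
      (∀ z, ‖fderiv ℝ φ z‖ ≤ c₁) ∧ (∀ z, |(Δ φ) z| ≤ c₂) := by
  obtain ⟨φ₀, h₁, h₂⟩ :
      ∃ φ₀ : ContDiffBump (0 : EuclideanSpace ℝ (Fin 3)), φ₀.rIn = 1 ∧ φ₀.rOut = 2 :=
    ⟨⟨1, 2, one_pos, one_lt_two⟩, rfl, rfl⟩
  have hφ₀s : ContDiff ℝ ∞ φ₀ := φ₀.contDiff
  have hφ₀c : HasCompactSupport φ₀ := φ₀.hasCompactSupport
  obtain ⟨c₁, hc₁⟩ := (hφ₀c.fderiv (𝕜 := ℝ)).exists_bound_of_continuous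
    (hφ₀s.continuous_fderiv (by simp))
  have hΔc : Continuous (Δ (φ₀ : EuclideanSpace ℝ (Fin 3) → ℝ)) :=
    Literature.Analysis.FluidPDE.continuous_laplacian (hφ₀s.of_le (by norm_cast))
  have hΔs : HasCompactSupport (Δ (φ₀ : EuclideanSpace ℝ (Fin 3) → ℝ)) :=
    hφ₀c.mono' (support_subset_iff'.2 fun z hz =>
      Literature.Analysis.FluidPDE.laplacian_eq_zero_of_notMem_tsupport hz)
  obtain ⟨c₂, hc₂⟩ := hΔs.exists_bound_of_continuous hΔc
  refine ⟨max c₁ 0, max c₂ 0, le_max_right _ _, le_max_right _ _, fun x₀ => ?_⟩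
  refine ⟨fun z => φ₀ (z - x₀), hφ₀s.comp (contDiff_id.sub contDiff_const), ?_,
    fun z => φ₀.nonneg, fun z => φ₀.le_one, fun z hz => ?_, fun z hz => ?_, fun z => ?_,
    fun z => ?_⟩
  · refine HasCompactSupport.of_support_subset_isCompact (isCompact_closedBall x₀ 2)
      (support_subset_iff'.2 fun z hz => φ₀.zero_of_le_dist ?_)
    rw [h₂, dist_zero_right, ← dist_eq_norm]
    exact (not_le.1 fun h => hz (mem_closedBall.2 h)).le
  · refine φ₀.one_of_mem_closedBall (mem_closedBall.2 ?_)
    rw [h₁, dist_zero_right, ← dist_eq_norm]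
    exact (mem_ball.1 hz).le
  · refine φ₀.zero_of_le_dist ?_
    rw [h₂, dist_zero_right, ← dist_eq_norm]
    exact not_lt.1 fun h => hz (mem_ball.2 h)
  · rw [fderiv_comp_sub x₀]
    exact (hc₁ _).trans (le_max_left _ _)
  · have e : (Δ fun z => φ₀ (z - x₀)) z = (Δ (φ₀ : EuclideanSpace ℝ (Fin 3) → ℝ)) (z - x₀) := by
      rw [InnerProductSpace.laplacian_eq_iteratedFDeriv_stdOrthonormalBasis,
        InnerProductSpace.laplacian_eq_iteratedFDeriv_stdOrthonormalBasis]
      simp only [iteratedFDeriv_comp_sub]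
    rw [e]
    exact ((Real.norm_eq_abs _).symm.le.trans (hc₂ _)).trans (le_max_left _ _)

/-- At a zero of a nonnegative function the derivative vanishes (a local minimum). -/
theorem fpl_LFL_fderiv_eq_zero {φ : EuclideanSpace ℝ (Fin 3) → ℝ} (h0 : ∀ z, 0 ≤ φ z)
    {z : EuclideanSpace ℝ (Fin 3)} (hz : φ z = 0) :
    fderiv ℝ φ z = 0 :=
  IsLocalMin.fderiv_eq_zero (Eventually.of_forall fun y => by rw [hz]; exact h0 y)

/-- A function vanishing off a ball `B_ρ(x₀)` has compact support. -/
theorem fpl_LFL_hasCompactSupport {f : EuclideanSpace ℝ (Fin 3) → ℝ} {x₀ : EuclideanSpace ℝ (Fin 3)}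
    {ρ : ℝ}
    (h0 : ∀ z, z ∉ ball x₀ ρ → f z = 0) : HasCompactSupport f :=
  HasCompactSupport.of_support_subset_isCompact (isCompact_closedBall x₀ ρ)
    (support_subset_iff'.2 fun z hz => h0 z fun h => hz (ball_subset_closedBall h))

/-- Continuous functions are integrable on balls. -/
theorem fpl_LFL_integrableOn_ball {f : EuclideanSpace ℝ (Fin 3) → ℝ} (hf : Continuous f)
    (x₀ : EuclideanSpace ℝ (Fin 3)) (ρ : ℝ) :
    IntegrableOn f (ball x₀ ρ) volume :=
  (hf.continuousOn.integrableOn_compact (isCompact_closedBall x₀ ρ)).mono_set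
    ball_subset_closedBall

/-- Comparison of a whole-space integral supported in a ball with a ball integral:
`f ≤ K g` on `B_ρ(x₀)` and `f = 0` off it give `∫ f ≤ K ∫_{B_ρ(x₀)} g`. -/
theorem fpl_LFL_integral_le_mul_setIntegral {x₀ : EuclideanSpace ℝ (Fin 3)} {ρ K : ℝ}
    {f g : EuclideanSpace ℝ (Fin 3) → ℝ}
    (hf : IntegrableOn f (ball x₀ ρ) volume) (hg : IntegrableOn g (ball x₀ ρ) volume)
    (hfg : ∀ z ∈ ball x₀ ρ, f z ≤ K * g z) (hf0 : ∀ z, z ∉ ball x₀ ρ → f z = 0) :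
    ∫ z, f z ≤ K * ∫ z in ball x₀ ρ, g z := by
  rw [← setIntegral_eq_integral_of_forall_compl_eq_zero hf0, ← integral_const_mul]
  exact setIntegral_mono_on hf (hg.const_mul K) measurableSet_ball hfg

/-- Hölder with `p = q = 2` for real functions: `∫ |f| |g| ≤ ‖f‖₂ ‖g‖₂`. -/
theorem fpl_LFL_integral_abs_mul_abs_le {f g : EuclideanSpace ℝ (Fin 3) → ℝ} (hf : MemLp f 2 volume)
    (hg : MemLp g 2 volume) :
    ∫ z, |f z| * |g z| ≤ Real.sqrt (∫ z, f z ^ 2) * Real.sqrt (∫ z, g z ^ 2) := by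
  have hf' : MemLp (fun z => |f z|) (ENNReal.ofReal 2) volume := by
    rw [ENNReal.ofReal_ofNat]; simpa only [Real.norm_eq_abs] using hf.norm
  have hg' : MemLp (fun z => |g z|) (ENNReal.ofReal 2) volume := by
    rw [ENNReal.ofReal_ofNat]; simpa only [Real.norm_eq_abs] using hg.norm
  have h := integral_mul_le_Lp_mul_Lq_of_nonneg Real.HolderConjugate.two_two
    (Eventually.of_forall fun z => abs_nonneg (f z))
    (Eventually.of_forall fun z => abs_nonneg (g z)) hf' hg'
  simp only [Real.rpow_two, sq_abs] at h
  rwa [Real.sqrt_eq_rpow, Real.sqrt_eq_rpow]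

/-- The bookkeeping of square roots in the near-pressure term:
`X ≤ a (C²/s) B`, `Y ≤ b B` give `√X √Y ≤ √(ab) · C B/√s`. -/
theorem fpl_LFL_sqrt_mul_sqrt_le {X Y a b B C s : ℝ} (hX : 0 ≤ X) (hY : 0 ≤ Y) (ha : 0 ≤ a)
    (hb : 0 ≤ b) (hB : 0 ≤ B) (hC : 0 ≤ C) (hs : 0 < s) (hXb : X ≤ a * (C ^ 2 / s) * B)
    (hYb : Y ≤ b * B) :
    Real.sqrt X * Real.sqrt Y ≤ Real.sqrt (a * b) * (C * B / Real.sqrt s) := by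
  rw [← Real.sqrt_mul hX]
  have hq : 0 ≤ C * B / Real.sqrt s := by positivity
  have e : a * b * (C * B / Real.sqrt s) ^ 2 = a * (C ^ 2 / s) * B * (b * B) := by
    rw [div_pow, Real.sq_sqrt hs.le]; ring
  calc Real.sqrt (X * Y) ≤ Real.sqrt (a * b * (C * B / Real.sqrt s) ^ 2) :=
        Real.sqrt_le_sqrt (by rw [e]; exact mul_le_mul hXb hYb hY (by positivity))
    _ = Real.sqrt (a * b) * (C * B / Real.sqrt s) := by
        rw [Real.sqrt_mul (mul_nonneg ha hb), Real.sqrt_sq hq]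

/-- `τ ↦ (−τ)^{-1/2}` is interval integrable on `[s', t'] ⊂ (−∞, 0)`. -/
theorem fpl_LFL_intervalIntegrable_inv_sqrt (s' t' : ℝ) (hst : s' ≤ t') (ht' : t' < 0) :
    IntervalIntegrable (fun τ => (Real.sqrt (-τ))⁻¹) volume s' t' := by
  refine (ContinuousOn.inv₀ (Real.continuous_sqrt.comp continuous_neg).continuousOn
    fun τ hτ => ?_).intervalIntegrable
  rw [uIcc_of_le hst] at hτ
  exact (Real.sqrt_pos.2 (by linarith [hτ.2])).ne'

/-- The crossing number: `∫_{s'}^{t'} (−τ)^{-1/2} dτ = 2 (√(−s') − √(−t'))` for `s' ≤ t' < 0`. -/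
theorem fpl_LFL_integral_inv_sqrt (s' t' : ℝ) (hst : s' ≤ t') (ht' : t' < 0) :
    ∫ τ in s'..t', (Real.sqrt (-τ))⁻¹ = 2 * (Real.sqrt (-s') - Real.sqrt (-t')) := by
  have hderiv : ∀ τ ∈ uIcc s' t',
      HasDerivAt (fun σ => -2 * Real.sqrt (-σ)) ((Real.sqrt (-τ))⁻¹) τ := by
    intro τ hτ
    rw [uIcc_of_le hst] at hτ
    have hτ0 : 0 < -τ := by linarith [hτ.2]
    have hne : Real.sqrt (-τ) ≠ 0 := (Real.sqrt_pos.2 hτ0).ne'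
    have h1 : HasDerivAt (fun σ : ℝ => -σ) (-1) τ := (hasDerivAt_id τ).neg
    refine ((h1.sqrt hτ0.ne').const_mul (-2)).congr_deriv ?_
    field_simp
  rw [intervalIntegral.integral_eq_sub_of_hasDerivAt hderiv
    (fpl_LFL_intervalIntegrable_inv_sqrt s' t' hst ht')]
  ring

/-- A weakly divergence-free field pairs to zero with the gradient of a test function:
`∫ Dφ(x)(v(x)) dx = 0`. -/
theorem fpl_LFL_integral_fderiv_apply_eq_zero
    {v : EuclideanSpace ℝ (Fin 3) → EuclideanSpace ℝ (Fin 3)} (hv : IsWeaklyDivFree v)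
    {φ : EuclideanSpace ℝ (Fin 3) → ℝ} (hφ : ContDiff ℝ ∞ φ) (hφc : HasCompactSupport φ) :
    ∫ z, fderiv ℝ φ z (v z) = 0 := by
  refine Eq.trans (integral_congr_ae (Eventually.of_forall fun z => ?_))
    (hv φ ⟨hφ, hφc, fun _ _ => trivial⟩)
  show fderiv ℝ φ z (v z) = ⟪v z, gradient φ z⟫
  rw [real_inner_comm]
  unfold gradient
  rw [InnerProductSpace.toDual_symm_apply]

section Slice

variable {x₀ : EuclideanSpace ℝ (Fin 3)} {φ : EuclideanSpace ℝ (Fin 3) → ℝ}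
  {v : EuclideanSpace ℝ (Fin 3) → EuclideanSpace ℝ (Fin 3)} {c₁ c₂ M : ℝ}

/-- The Laplacian of a function vanishing off `B₂(x₀)` vanishes off `B₃(x₀)` (indeed off
`B̄₂(x₀) ⊇ tsupport`). -/
theorem fpl_LFL_laplacian_eq_zero (hφ2 : ∀ z, z ∉ ball x₀ 2 → φ z = 0)
    {z : EuclideanSpace ℝ (Fin 3)}
    (hz : z ∉ ball x₀ 3) : (Δ φ) z = 0 := by
  have hts : tsupport φ ⊆ ball x₀ 3 :=
    (closure_mono (support_subset_iff'.2 hφ2)).trans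
      (closure_ball_subset_closedBall.trans (closedBall_subset_ball (by norm_num)))
  exact Literature.Analysis.FluidPDE.laplacian_eq_zero_of_notMem_tsupport fun h => hz (hts h)

/-- The Laplacian term: `∫ Δφ |v|² ≤ c₂ ∫_{B₃(x₀)} |v|²`. -/
theorem fpl_LFL_laplacian_term_le (hφ : ContDiff ℝ ∞ φ) (hφ2 : ∀ z, z ∉ ball x₀ 2 → φ z = 0)
    (hc₂ : ∀ z, |(Δ φ) z| ≤ c₂) (hv : Continuous v) :
    ∫ z, 1 * ((Δ φ) z * ‖v z‖ ^ 2) ≤ c₂ * ∫ z in ball x₀ 3, ‖v z‖ ^ 2 := by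
  have hΔ : Continuous (Δ φ) :=
    Literature.Analysis.FluidPDE.continuous_laplacian (hφ.of_le (by norm_cast))
  refine fpl_LFL_integral_le_mul_setIntegral
    (fpl_LFL_integrableOn_ball (continuous_const.mul (hΔ.mul (hv.norm.pow 2))) x₀ 3)
    (fpl_LFL_integrableOn_ball (hv.norm.pow 2) x₀ 3) (fun z _ => ?_) (fun z hz => ?_)
  · rw [one_mul]
    exact (mul_le_mul_of_nonneg_right (le_abs_self _) (sq_nonneg _)).trans
      (mul_le_mul_of_nonneg_right (hc₂ z) (sq_nonneg _))
  · rw [fpl_LFL_laplacian_eq_zero hφ2 hz, zero_mul, mul_zero]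

/-- The transport term: `∫ Dφ(v)|v|² ≤ c₁ M ∫_{B₂(x₀)} |v|²` (one factor `‖v‖ ≤ M` is spent). -/
theorem fpl_LFL_transport_term_le (hφ : ContDiff ℝ ∞ φ) (hφ0 : ∀ z, 0 ≤ φ z)
    (hφ2 : ∀ z, z ∉ ball x₀ 2 → φ z = 0) (hc₁ : ∀ z, ‖fderiv ℝ φ z‖ ≤ c₁) (hv : Continuous v)
    (hvM : ∀ z, ‖v z‖ ≤ M) :
    ∫ z, fderiv ℝ φ z (v z) * ‖v z‖ ^ 2 ≤ c₁ * M * ∫ z in ball x₀ 2, ‖v z‖ ^ 2 := by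
  have hD : Continuous fun z => fderiv ℝ φ z (v z) :=
    (hφ.continuous_fderiv (by simp)).clm_apply hv
  refine fpl_LFL_integral_le_mul_setIntegral
    (fpl_LFL_integrableOn_ball (hD.mul (hv.norm.pow 2)) x₀ 2)
    (fpl_LFL_integrableOn_ball (hv.norm.pow 2) x₀ 2) (fun z _ => ?_) (fun z hz => ?_)
  · refine mul_le_mul_of_nonneg_right ((le_abs_self _).trans ?_) (sq_nonneg _)
    rw [← Real.norm_eq_abs]
    exact ((fderiv ℝ φ z).le_opNorm _).trans
      (mul_le_mul (hc₁ z) (hvM z) (norm_nonneg _) ((norm_nonneg _).trans (hc₁ z)))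
  · rw [fpl_LFL_fderiv_eq_zero hφ0 (hφ2 z hz), zero_apply, zero_mul]

/-- The square of the pairing: `∫ (Dφ(v))² ≤ c₁² ∫_{B₂(x₀)} |v|²`. -/
theorem fpl_LFL_fderiv_apply_sq_le (hφ : ContDiff ℝ ∞ φ) (hφ0 : ∀ z, 0 ≤ φ z)
    (hφ2 : ∀ z, z ∉ ball x₀ 2 → φ z = 0) (hc₁ : ∀ z, ‖fderiv ℝ φ z‖ ≤ c₁) (hv : Continuous v) :
    ∫ z, (fderiv ℝ φ z (v z)) ^ 2 ≤ c₁ ^ 2 * ∫ z in ball x₀ 2, ‖v z‖ ^ 2 := by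
  have hD : Continuous fun z => fderiv ℝ φ z (v z) :=
    (hφ.continuous_fderiv (by simp)).clm_apply hv
  refine fpl_LFL_integral_le_mul_setIntegral (fpl_LFL_integrableOn_ball (hD.pow 2) x₀ 2)
    (fpl_LFL_integrableOn_ball (hv.norm.pow 2) x₀ 2) (fun z _ => ?_) (fun z hz => ?_)
  · rw [← mul_pow, ← sq_abs, ← Real.norm_eq_abs]
    exact pow_le_pow_left₀ (norm_nonneg _) (((fderiv ℝ φ z).le_opNorm _).trans
      (mul_le_mul_of_nonneg_right (hc₁ z) (norm_nonneg _))) 2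
  · rw [fpl_LFL_fderiv_eq_zero hφ0 (hφ2 z hz), zero_apply]
    ring

/-- The pressure term against a pairing density `D` (`= Dφ(v)`) supported in `B₂(x₀)`, bounded
by `K` and of mean zero: writing `q = c + p₁ + p₂` on `B₂(x₀)`, the constants `c` and `p₂(x₀)`
drop out, the near part is Hölder and the far part is the mean value inequality
`|p₂(z) − p₂(x₀)| ≤ 2L` on the convex ball: `∫ 2 q D ≤ 2 ‖p₁‖₂ ‖D‖₂ + 4 L K |B₂|`. -/
theorem fpl_LFL_pressure_term_le {D q p₁ p₂ : EuclideanSpace ℝ (Fin 3) → ℝ} {c K L V : ℝ}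
    (hDc : Continuous D)
    (hD0 : ∀ z, z ∉ ball x₀ 2 → D z = 0) (hK : 0 ≤ K) (hDbd : ∀ z, |D z| ≤ K)
    (hID : ∫ z, D z = 0) (hq : Continuous q) (hdec : ∀ z ∈ ball x₀ 2, q z = c + p₁ z + p₂ z)
    (hp₁ : MemLp p₁ 2 volume)
    (hp₂ : ∀ z ∈ ball x₀ 2, DifferentiableAt ℝ p₂ z ∧ ‖fderiv ℝ p₂ z‖ ≤ L)
    (hV : volume.real (ball x₀ 2) ≤ V) :
    ∫ z, 2 * (q z * D z) ≤
      2 * (Real.sqrt (∫ z, p₁ z ^ 2) * Real.sqrt (∫ z, D z ^ 2)) + 4 * L * K * V := by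
  have hDs : HasCompactSupport D := fpl_LFL_hasCompactSupport hD0
  have iD : Integrable D volume := hDc.integrable_of_hasCompactSupport hDs
  have mD : MemLp D 2 volume := hDc.memLp_of_hasCompactSupport hDs
  have iT : Integrable (fun z => 2 * (q z * D z)) volume :=
    (continuous_const.mul (hq.mul hDc)).integrable_of_hasCompactSupport
      (fpl_LFL_hasCompactSupport fun z hz => by
        show (2 : ℝ) * (q z * D z) = 0
        rw [hD0 z hz, mul_zero, mul_zero])
  have iA : Integrable (fun z => 2 * (c + p₂ x₀) * D z) volume := iD.const_mul _
  have iP : Integrable (fun z => p₁ z * D z) volume := hp₁.integrable_mul mD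
  have iP2 : Integrable (fun z => 2 * (p₁ z * D z)) volume := iP.const_mul 2
  have iW : Integrable
      (fun z => 2 * (q z * D z) - 2 * (c + p₂ x₀) * D z - 2 * (p₁ z * D z)) volume :=
    (iT.sub iA).sub iP2
  have hL0 : 0 ≤ L := (norm_nonneg _).trans (hp₂ x₀ (mem_ball_self two_pos)).2
  -- the far part, pointwise
  have hWeq : ∀ z, 2 * (q z * D z) - 2 * (c + p₂ x₀) * D z - 2 * (p₁ z * D z) =
      2 * ((p₂ z - p₂ x₀) * D z) := by
    intro z
    by_cases hz : z ∈ ball x₀ 2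
    · rw [hdec z hz]; ring
    · rw [hD0 z hz]; ring
  have hWbd : ∀ z, |2 * (q z * D z) - 2 * (c + p₂ x₀) * D z - 2 * (p₁ z * D z)| ≤
      2 * (2 * L * K) := by
    intro z
    rw [hWeq z]
    by_cases hz : z ∈ ball x₀ 2
    · rw [abs_mul, abs_mul, abs_two]
      refine mul_le_mul_of_nonneg_left (mul_le_mul ?_ (hDbd z) (abs_nonneg _) (by positivity))
        zero_le_two
      have hmv := (convex_ball x₀ 2).norm_image_sub_le_of_norm_fderiv_le
        (fun y hy => (hp₂ y hy).1) (fun y hy => (hp₂ y hy).2) (mem_ball_self two_pos) hz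
      rw [Real.norm_eq_abs] at hmv
      refine hmv.trans ?_
      rw [mul_comm]
      exact mul_le_mul_of_nonneg_right (mem_ball_iff_norm.1 hz).le hL0
    · rw [hD0 z hz, mul_zero, mul_zero, abs_zero]
      positivity
  have hW0 : ∀ z, z ∉ ball x₀ 2 →
      2 * (q z * D z) - 2 * (c + p₂ x₀) * D z - 2 * (p₁ z * D z) = 0 := fun z hz => by
    rw [hWeq z, hD0 z hz, mul_zero, mul_zero]
  have hIW : ∫ z, (2 * (q z * D z) - 2 * (c + p₂ x₀) * D z - 2 * (p₁ z * D z)) ≤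
      4 * L * K * V := by
    rw [← setIntegral_eq_integral_of_forall_compl_eq_zero hW0]
    refine (Real.le_norm_self _).trans ((norm_setIntegral_le_of_norm_le_const
      measure_ball_lt_top fun z _ => (Real.norm_eq_abs _).le.trans (hWbd z)).trans ?_)
    calc 2 * (2 * L * K) * volume.real (ball x₀ 2) ≤ 2 * (2 * L * K) * V :=
          mul_le_mul_of_nonneg_left hV (by positivity)
      _ = 4 * L * K * V := by ring
  have hIA : ∫ z, 2 * (c + p₂ x₀) * D z = 0 := by
    rw [integral_const_mul, hID, mul_zero]
  have hIP : ∫ z, 2 * (p₁ z * D z) ≤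
      2 * (Real.sqrt (∫ z, p₁ z ^ 2) * Real.sqrt (∫ z, D z ^ 2)) := by
    rw [integral_const_mul]
    refine mul_le_mul_of_nonneg_left ?_ zero_le_two
    calc ∫ z, p₁ z * D z ≤ ∫ z, |p₁ z * D z| := integral_mono iP iP.abs fun z => le_abs_self _
      _ = ∫ z, |p₁ z| * |D z| := integral_congr_ae (Eventually.of_forall fun z => abs_mul _ _)
      _ ≤ _ := fpl_LFL_integral_abs_mul_abs_le hp₁ mD
  have iAP : Integrable (fun z => 2 * (c + p₂ x₀) * D z + 2 * (p₁ z * D z)) volume :=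
    iA.add iP2
  have hsplit : ∫ z, 2 * (q z * D z) =
      (∫ z, 2 * (c + p₂ x₀) * D z) + (∫ z, 2 * (p₁ z * D z)) +
        ∫ z, (2 * (q z * D z) - 2 * (c + p₂ x₀) * D z - 2 * (p₁ z * D z)) := by
    rw [← integral_add iA iP2, ← integral_add iAP iW]
    refine integral_congr_ae (Eventually.of_forall fun z => ?_)
    ring
  rw [hsplit, hIA, zero_add]
  exact add_le_add hIP hIW

/-- The flux at a fixed time, all three terms:
`∫ (Δφ|v|² + Dφ(v)|v|² + 2 q Dφ(v))`
`  ≤ c₂ ∫_{B₃}|v|² + c₁M ∫_{B₂}|v|² + 2‖p₁‖₂ (c₁² ∫_{B₂}|v|²)^{1/2} + 4 L c₁ M |B₂|`. -/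
theorem fpl_LFL_flux_slice_le {q p₁ p₂ : EuclideanSpace ℝ (Fin 3) → ℝ} {c L V : ℝ}
    (hφ : ContDiff ℝ ∞ φ)
    (hφc : HasCompactSupport φ) (hφ0 : ∀ z, 0 ≤ φ z) (hφ2 : ∀ z, z ∉ ball x₀ 2 → φ z = 0)
    (hc₁ : ∀ z, ‖fderiv ℝ φ z‖ ≤ c₁) (hc₂ : ∀ z, |(Δ φ) z| ≤ c₂) (hv : Continuous v)
    (hdiv : IsWeaklyDivFree v) (hM : 0 ≤ M) (hvM : ∀ z, ‖v z‖ ≤ M) (hq : Continuous q)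
    (hdec : ∀ z ∈ ball x₀ 2, q z = c + p₁ z + p₂ z) (hp₁ : MemLp p₁ 2 volume)
    (hp₂ : ∀ z ∈ ball x₀ 2, DifferentiableAt ℝ p₂ z ∧ ‖fderiv ℝ p₂ z‖ ≤ L)
    (hV : volume.real (ball x₀ 2) ≤ V) :
    ∫ z, (1 * ((Δ φ) z * ‖v z‖ ^ 2) + fderiv ℝ φ z (v z) * ‖v z‖ ^ 2 +
        2 * (q z * fderiv ℝ φ z (v z))) ≤
      (c₂ * ∫ z in ball x₀ 3, ‖v z‖ ^ 2) + (c₁ * M * ∫ z in ball x₀ 2, ‖v z‖ ^ 2) +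
        (2 * (Real.sqrt (∫ z, p₁ z ^ 2) * Real.sqrt (c₁ ^ 2 * ∫ z in ball x₀ 2, ‖v z‖ ^ 2)) +
          4 * L * (c₁ * M) * V) := by
  have hΔ : Continuous (Δ φ) :=
    Literature.Analysis.FluidPDE.continuous_laplacian (hφ.of_le (by norm_cast))
  have hDc : Continuous fun z => fderiv ℝ φ z (v z) :=
    (hφ.continuous_fderiv (by simp)).clm_apply hv
  have hD0 : ∀ z, z ∉ ball x₀ 2 → fderiv ℝ φ z (v z) = 0 := fun z hz => by
    rw [fpl_LFL_fderiv_eq_zero hφ0 (hφ2 z hz), zero_apply]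
  have hc₁0 : 0 ≤ c₁ := (norm_nonneg _).trans (hc₁ x₀)
  have hDbd : ∀ z, |fderiv ℝ φ z (v z)| ≤ c₁ * M := fun z => by
    rw [← Real.norm_eq_abs]
    exact ((fderiv ℝ φ z).le_opNorm _).trans (mul_le_mul (hc₁ z) (hvM z) (norm_nonneg _) hc₁0)
  have i1 : Integrable (fun z => 1 * ((Δ φ) z * ‖v z‖ ^ 2)) volume :=
    (continuous_const.mul (hΔ.mul (hv.norm.pow 2))).integrable_of_hasCompactSupport
      (fpl_LFL_hasCompactSupport (ρ := 3) fun z hz => by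
        show (1 : ℝ) * ((Δ φ) z * ‖v z‖ ^ 2) = 0
        rw [fpl_LFL_laplacian_eq_zero hφ2 hz, zero_mul, mul_zero])
  have i2 : Integrable (fun z => fderiv ℝ φ z (v z) * ‖v z‖ ^ 2) volume :=
    (hDc.mul (hv.norm.pow 2)).integrable_of_hasCompactSupport
      (fpl_LFL_hasCompactSupport fun z hz => by
        show fderiv ℝ φ z (v z) * ‖v z‖ ^ 2 = 0
        rw [hD0 z hz, zero_mul])
  have i12 : Integrable
      (fun z => 1 * ((Δ φ) z * ‖v z‖ ^ 2) + fderiv ℝ φ z (v z) * ‖v z‖ ^ 2) volume := i1.add i2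
  have i3 : Integrable (fun z => 2 * (q z * fderiv ℝ φ z (v z))) volume :=
    (continuous_const.mul (hq.mul hDc)).integrable_of_hasCompactSupport
      (fpl_LFL_hasCompactSupport fun z hz => by
        show (2 : ℝ) * (q z * fderiv ℝ φ z (v z)) = 0
        rw [hD0 z hz, mul_zero, mul_zero])
  rw [integral_add i12 i3, integral_add i1 i2]
  refine add_le_add (add_le_add (fpl_LFL_laplacian_term_le hφ hφ2 hc₂ hv)
    (fpl_LFL_transport_term_le hφ hφ0 hφ2 hc₁ hv hvM)) ?_
  refine (fpl_LFL_pressure_term_le (D := fun z => fderiv ℝ φ z (v z)) hDc hD0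
    (mul_nonneg hc₁0 hM) hDbd (fpl_LFL_integral_fderiv_apply_eq_zero hdiv hφ hφc) hq hdec hp₁
    hp₂ hV).trans ?_
  refine add_le_add (mul_le_mul_of_nonneg_left (mul_le_mul_of_nonneg_left
    (Real.sqrt_le_sqrt ?_) (Real.sqrt_nonneg _)) zero_le_two) le_rfl
  exact fpl_LFL_fderiv_apply_sq_le hφ hφ0 hφ2 hc₁ hv

end Slice

/-- **Registered tools sub-goal of stub LFL**: the slice flux bound `fpl_LFL_flux_slice_le` with
all binders explicit and all names fully qualified (the form registered on the crux item). -/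
theorem fpl_LFL_fluxSliceBound :
    ∀ (x₀ : EuclideanSpace ℝ (Fin 3)) (φ : EuclideanSpace ℝ (Fin 3) → ℝ) (v : EuclideanSpace ℝ
    (Fin 3) → EuclideanSpace ℝ (Fin 3)) (q p₁ p₂ : EuclideanSpace ℝ (Fin 3) → ℝ) (c₁ c₂ M c L V :
    ℝ), ContDiff ℝ (⊤ : ℕ∞) φ → HasCompactSupport φ → (∀ z, 0 ≤ φ z) → (∀ z, z ∉ Metric.ball x₀ 2
    → φ z = 0) → (∀ z, ‖fderiv ℝ φ z‖ ≤ c₁) → (∀ z, |Laplacian.laplacian φ z| ≤ c₂) → Continuous v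
    → Literature.Analysis.FluidPDE.IsWeaklyDivFree v → 0 ≤ M → (∀ z, ‖v z‖ ≤ M) → Continuous q →
    (∀ z ∈ Metric.ball x₀ 2, q z = c + p₁ z + p₂ z) → MeasureTheory.MemLp p₁ 2
    MeasureTheory.volume → (∀ z ∈ Metric.ball x₀ 2, DifferentiableAt ℝ p₂ z ∧ ‖fderiv ℝ p₂ z‖ ≤ L)
    → MeasureTheory.volume.real (Metric.ball x₀ 2) ≤ V → ∫ z, (1 * (Laplacian.laplacian φ z * ‖v
    z‖ ^ 2) + fderiv ℝ φ z (v z) * ‖v z‖ ^ 2 + 2 * (q z * fderiv ℝ φ z (v z))) ≤ (c₂ * ∫ z in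
    Metric.ball x₀ 3, ‖v z‖ ^ 2) + (c₁ * M * ∫ z in Metric.ball x₀ 2, ‖v z‖ ^ 2) + (2 * (Real.sqrt
    (∫ z, p₁ z ^ 2) * Real.sqrt (c₁ ^ 2 * ∫ z in Metric.ball x₀ 2, ‖v z‖ ^ 2)) + 4 * L * (c₁ * M)
    * V) :=
  fun _ _ _ _ _ _ _ _ _ _ _ _ hφ hφc hφ0 hφ2 hc₁ hc₂ hv hdiv hM hvM hq hdec hp₁ hp₂ hV =>
    fpl_LFL_flux_slice_le hφ hφc hφ0 hφ2 hc₁ hc₂ hv hdiv hM hvM hq hdec hp₁ hp₂ hV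

end Summit.NavierStokesRegularity.NavierStokesRegularity.Theorems

end
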